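import Literature.NumberTheory.GelbartRogawski1991.Prop311RhoPsiUnique
import Literature.NumberTheory.GelbartRogawski1991.Prop311AdelicProjections
import Literature.RepresentationTheory.HeisenbergGroup.LatticeModelIrreducible
import Literature.RepresentationTheory.HeisenbergGroup.LatticeModelContinuous
import Literature.RepresentationTheory.HeisenbergGroup.HeisenbergRealExistence
import Literature.NumberTheory.Automorphic.HilbertRepSchur
import HarnessLib

/-!
# [GelbartRogawski1991, §3.1 p. 454 L19–21]: EXISTENCE of the printed `ρ_ψ` — an irreducible unitary `ψ`-representation of `H_𝐀(W)`

Topic `NumberTheory/GelbartRogawski1991`; namespace `Literature.NumberTheory.GelbartRogawski1991.Prop311`.  KERNEL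
ONLY: theorems; no definition, no named fact, no `sorry`; `Prop311AsPrinted` itself is untouched.

[GelbartRogawski1991, §3.1 p. 454 L19–21] (verbatim): "*For each non-trivial character `ψ`, let `ρ_ψ` be an irreducible
unitary representation of `H_𝐀(W)` with central character `ψ` (`ρ_ψ` is unique up to isomorphism).*"  The
statement-exact typing `Prop311AsPrinted` quantifies over such a `ρ_ψ` (binders `S ρ _hρu _hρc _hρi _hρz`, renderings
R6/R8); `Prop311RhoPsiUnique.rho_unique` proves the uniqueness.  This file proves EXISTENCE (**`rho_exists`**): for the
printed data there IS a Hilbert space `S ≠ 0` and a representation `ρ` of `H_𝐀(W) = Prop311.AdelicHeisenberg F E V Φ`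
that is isometric, has continuous orbit maps for `heisenbergTopology`, has no closed invariant subspace other than
`⊥`, `⊤`, and has central character `ψ` — so the binder list of `Prop311AsPrinted` is not vacuous.

The model (no Hilbert tensor product needed): in the adelic Darboux coordinates of `Prop311AdelicCoordinates`,
`H_𝐀(W)` maps homomorphically onto its archimedean part `H(W_∞) = Heisenberg (altPolar ·)` over `ℝ^{r₁} × ℂ^{r₂}`
(`Prop311AdelicProjections.exists_archProj`) and onto its finite part `H(W_fin) = Heisenberg (polar ·)` over `𝐀_F^∞`
(`exists_finProj`); the space is
`ℓ²((𝐀_F^∞)²ⁿ/((∏𝒪_v)ⁿ × (∏𝔠_{ψ_v})ⁿ); L²(ℝᵐ))` carrying the LATTICE MODEL of `H(W_fin)` (`HeisenbergGroup/LatticeModel`,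
central character `ψ_f = ∏ψ_v`, the dual lattice pair of `FiniteAdeleDualLatticePair`) with coefficients in the
Schrödinger model of `H(W_∞)` (`HeisenbergRealExistence`, central character `e ∘ ℓ = ψ_∞`,
`AdeleAddCharArchimedeanLinearForm`); the two commute and are jointly irreducible (`LatticeModel.irreducible`, with
Schur's lemma for the archimedean factor, `HilbertRepSchur`), continuous (`LatticeModel.continuous_rep_mk_zero`,
`continuous_coeff_apply`), and the central character is `ψ_∞ ⊗ ψ_f = ψ` (`AdeleAddCharProductFormula`).

## References
* [GelbartRogawski1991] S. Gelbart, J. Rogawski, Invent. Math. 105 (1991), §3.1 p. 454 L17–21.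
* [MoeglinVignerasWaldspurger1987] C. Mœglin, M.-F. Vignéras, J.-L. Waldspurger, LNM 1291 (1987), Chap. 2, I.3, II.8.
* [Weil1964] A. Weil, Acta Math. 111 (1964), Chap. I n° 11–13, Chap. III n° 37–39.
* [Folland1989] G. B. Folland, *Harmonic Analysis in Phase Space* (1989), §1.5 Thm. (1.50).
-/

set_option autoImplicit false

noncomputable section

open NumberField IsDedekindDomain NumberField.mixedEmbedding InfiniteAdeleRing Filter Topology MeasureTheory
open Literature.RepresentationTheory.HeisenbergGroup Literature.NumberTheory.Automorphic
open Literature.RepresentationTheory.HeisenbergGroup.RestrictedPair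
open scoped TensorProduct FourierTransform Pointwise RestrictedProduct ENNReal

namespace Literature.NumberTheory.GelbartRogawski1991

namespace Prop311

/-! ## §1 Two general lemmas: Schur for isometric irreducible actions; `L²(ℝᵐ) ≠ 0` -/

/-- **Schur's lemma** for a representation by isometries of a group on a Hilbert space with no closed invariant
subspace other than `⊥`, `⊤`: every bounded operator commuting with the action is a scalar (the tree's
`IsIrreducibleFamily.exists_eq_algebraMap`, the family `{π g}` being closed under adjoints `(π g)* = π g⁻¹`).
[cite: GelbartRogawski1991, §3.1 p. 454 L19–21] -/
theorem exists_smul_of_commute_of_irreducible {G H : Type*} [Group G] [NormedAddCommGroup H]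
    [InnerProductSpace ℂ H] [CompleteSpace H] (π : Representation ℂ G H)
    (hπu : ∀ (g : G) (v : H), ‖π g v‖ = ‖v‖)
    (hπi : ∀ K : Submodule ℂ H, IsClosed (K : Set H) → (∀ (g : G), ∀ v ∈ K, π g v ∈ K) → K = ⊥ ∨ K = ⊤)
    (T : H →L[ℂ] H) (hT : ∀ (g : G) (v : H), T (π g v) = π g (T v)) : ∃ c : ℂ, ∀ v, T v = c • v := by
  have hinv : ∀ g : G, (π g).comp (π g⁻¹) = LinearMap.id := fun g => by
    rw [← Module.End.mul_eq_comp, ← map_mul, mul_inv_cancel, map_one, Module.End.one_eq_id]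
  have hinv' : ∀ g : G, (π g⁻¹).comp (π g) = LinearMap.id := fun g => by
    rw [← Module.End.mul_eq_comp, ← map_mul, inv_mul_cancel, map_one, Module.End.one_eq_id]
  let U : G → (H ≃ₗᵢ[ℂ] H) := fun g =>
    { toLinearEquiv := LinearEquiv.ofLinear (π g) (π g⁻¹) (hinv g) (hinv' g)
      norm_map' := hπu g }
  have hU : ∀ (g : G) (v : H), ((U g : H ≃ₗᵢ[ℂ] H) : H →L[ℂ] H) v = π g v := fun _ _ => rfl
  have hUsymm : ∀ (g : G) (v : H), (U g).symm v = π g⁻¹ v := fun _ _ => rfl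
  let 𝒮 : Set (H →L[ℂ] H) := Set.range fun g => ((U g : H ≃ₗᵢ[ℂ] H) : H →L[ℂ] H)
  have h𝒮 : IsIrreducibleFamily 𝒮 := by
    intro W hWc hW
    exact hπi W hWc fun g v hv => (hU g v) ▸ hW _ ⟨g, rfl⟩ v hv
  have hstar : ∀ A ∈ 𝒮, ContinuousLinearMap.adjoint A ∈ 𝒮 := by
    rintro A ⟨g, rfl⟩
    refine ⟨g⁻¹, ContinuousLinearMap.ext fun v => ?_⟩
    rw [LinearIsometryEquiv.adjoint_eq_symm]
    change ((U g⁻¹ : H ≃ₗᵢ[ℂ] H) : H →L[ℂ] H) v = (U g).symm v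
    rw [hU, hUsymm]
  have hTc : ∀ A ∈ 𝒮, Commute A T := by
    rintro A ⟨g, rfl⟩
    refine ContinuousLinearMap.ext fun v => ?_
    change ((U g : H ≃ₗᵢ[ℂ] H) : H →L[ℂ] H) (T v) = T (((U g : H ≃ₗᵢ[ℂ] H) : H →L[ℂ] H) v)
    rw [hU, hU, hT]
  obtain ⟨c, hc⟩ := h𝒮.exists_eq_algebraMap hstar hTc
  exact ⟨c, fun v => by rw [hc, ContinuousLinearMap.algebraMap_apply]⟩

/-- **`L²(ℝᵐ)` is not the zero space** (the indicator of the unit cube has norm `1`).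
[cite: Folland1989, §1.5 Theorem (1.50)] -/
theorem nontrivial_Lp_volume (m : ℕ) : Nontrivial (Lp ℂ 2 (volume : Measure (Fin m → ℝ))) := by
  have hs : MeasurableSet (Set.Icc (0 : Fin m → ℝ) 1) := measurableSet_Icc
  have hμ : volume (Set.Icc (0 : Fin m → ℝ) 1) = 1 := by
    rw [Real.volume_Icc_pi]
    simp only [Pi.one_apply, Pi.zero_apply, sub_zero, ENNReal.ofReal_one, Finset.prod_const_one]
  have hμ' : volume (Set.Icc (0 : Fin m → ℝ) 1) ≠ ∞ := by rw [hμ]; exact ENNReal.one_ne_top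
  refine ⟨⟨indicatorConstLp 2 hs hμ' (1 : ℂ), 0, fun h0 => ?_⟩⟩
  have h1 := norm_indicatorConstLp (p := (2 : ℝ≥0∞)) (μ := (volume : Measure (Fin m → ℝ))) (hs := hs) (hμs := hμ')
    (c := (1 : ℂ)) two_ne_zero ENNReal.ofNat_ne_top
  rw [h0, norm_zero, norm_one, one_mul, measureReal_def, hμ, ENNReal.toReal_one, Real.one_rpow] at h1
  exact zero_ne_one h1


/-! ## §2 Existence of the printed `ρ_ψ` -/

set_option maxHeartbeats 800000 in
/-- **EXISTENCE of `ρ_ψ` [GelbartRogawski1991, §3.1 p. 454 L19–21] for the printed `H_𝐀(W)`**: for the data of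
`Prop311AsPrinted` (number field `F`, quadratic `E/F` with `σ`, non-trivial character `ψ` of `F\𝐀`, skew-Hermitian
`(V, Φ)` with `Tr Φ` non-degenerate) there exist a Hilbert space `S ≠ 0` and a representation `ρ` of
`H_𝐀(W) = Prop311.AdelicHeisenberg F E V Φ` on `S` which is isometric, has continuous orbit maps for
`heisenbergTopology`, no closed invariant subspace other than `⊥`, `⊤`, and central character `ψ` — the binders
`S ρ _hρu _hρc _hρi _hρz` of `Prop311AsPrinted` are inhabited. [cite: GelbartRogawski1991, §3.1 p. 454 L17–21] -/
theorem rho_exists (F : Type) [Field F] [NumberField F]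
    (E : Type) [Field E] [Algebra F E] [Algebra.IsQuadraticExtension F E] (σ : E ≃ₐ[F] E)
    (ψ : AddChar (AdeleRing (𝓞 F) F) Circle) (hψc : Continuous ψ)
    (hψF : ∀ x : F, ψ (algebraMap F (AdeleRing (𝓞 F) F) x) = 1) (hψ1 : ψ ≠ 1)
    (V : Type) [AddCommGroup V] [Module F V] [Module E V] [IsScalarTower F E V] [FiniteDimensional E V]
    (Φ : V →ₗ[F] V →ₗ[F] E) (hΦ₃ : ∀ x y : V, Φ y x = -σ (Φ x y)) (hφ : (traceForm F E V Φ).Nondegenerate) :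
    ∃ (S : Type) (_ : NormedAddCommGroup S) (_ : InnerProductSpace ℂ S) (_ : CompleteSpace S) (_ : Nontrivial S)
      (ρ : Representation ℂ (AdelicHeisenberg F E V Φ) S),
      (∀ (h : AdelicHeisenberg F E V Φ) (f : S), ‖ρ h f‖ = ‖f‖) ∧
      (∀ f : S, @Continuous _ _ (heisenbergTopology F E V Φ) _ fun h => ρ h f) ∧
      (∀ K : Submodule ℂ S, IsClosed (K : Set S) →
        (∀ (h : AdelicHeisenberg F E V Φ), ∀ f ∈ K, ρ h f ∈ K) → K = ⊥ ∨ K = ⊤) ∧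
      ∀ (t : AdeleRing (𝓞 F) F) (f : S),
        ρ (Heisenberg.ofCenter (heisForm F E V Φ) (Multiplicative.ofAdd t)) f = ((ψ t : Circle) : ℂ) • f := by
  classical
  haveI : FiniteDimensional F V := finite_restrictScalars F E V
  letI i2f : Invertible (2 : FiniteAdeleRing (𝓞 F) F) :=
    ((invertibleOfNonzero (two_ne_zero' F)).map (algebraMap F (FiniteAdeleRing (𝓞 F) F))).copy _
      (map_ofNat (algebraMap F (FiniteAdeleRing (𝓞 F) F)) 2).symm
  haveI : Fact (∀ v : HeightOneSpectrum (𝓞 F), IsOpen (v.adicCompletionIntegers F : Set (v.adicCompletion F))) :=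
    ⟨fun _ => Valued.isOpen_valuationSubring _⟩
  have hψ : IsGlobalAddChar F ψ := ⟨hψc, hψF, hψ1⟩
  obtain ⟨n, e, he⟩ := exists_adelicDarboux F E V Φ (isAlt_traceForm F E V Φ σ hΦ₃) hφ
  obtain ⟨ℓ, hℓψ, hℓnd, hℓsurj⟩ := hψ.exists_linearMap_fourierChar_eq
  -- topologies of record
  letI tW : TopologicalSpace (AdelicSpace F V) := adelicSpaceTopology F V
  letI tH : TopologicalSpace (AdelicHeisenberg F E V Φ) := heisenbergTopology F E V Φ
  haveI : IsModuleTopology (AdeleRing (𝓞 F) F) (AdelicSpace F V) := ⟨rfl⟩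
  -- the archimedean model
  set βM : (Fin n → mixedSpace F) →ₗ[mixedSpace F] (Fin n → mixedSpace F) →ₗ[mixedSpace F] mixedSpace F :=
    Matrix.toLinearMap₂' (mixedSpace F) (1 : Matrix (Fin n) (Fin n) (mixedSpace F)) with hβM
  have hs : (realForm (altPolar βM) ℓ - (realForm (altPolar βM) ℓ).flip).Nondegenerate :=
    nondegenerate_realForm_sub_flip (altPolar βM) ℓ hℓnd fun x hx =>
      exists_altPolar_sub_altPolar_ne_zero (isUnit_two_mixedSpace F) x hx
  obtain ⟨m, πa, hau, hac, haz, hai⟩ := exists_irreducible_unitary_rep (altPolar βM) ℓ hℓsurj hs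
  haveI : Nontrivial (Lp ℂ 2 (volume : Measure (Fin m → ℝ))) := nontrivial_Lp_volume m
  have ha' : ∀ T : Lp ℂ 2 (volume : Measure (Fin m → ℝ)) →L[ℂ] Lp ℂ 2 (volume : Measure (Fin m → ℝ)),
      (∀ (g : Heisenberg (altPolar βM)) (v : Lp ℂ 2 (volume : Measure (Fin m → ℝ))), T (πa g v) = πa g (T v)) →
        ∃ c : ℂ, ∀ v, T v = c • v :=
    exists_smul_of_commute_of_irreducible πa hau hai
  -- the finite-adelic data
  set βf : (Fin n → FiniteAdeleRing (𝓞 F) F) →ₗ[FiniteAdeleRing (𝓞 F) F]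
      (Fin n → FiniteAdeleRing (𝓞 F) F) →ₗ[FiniteAdeleRing (𝓞 F) F] FiniteAdeleRing (𝓞 F) F :=
    Matrix.toLinearMap₂' (FiniteAdeleRing (𝓞 F) F) (1 : Matrix (Fin n) (Fin n) (FiniteAdeleRing (𝓞 F) F)) with hβf
  obtain ⟨ψf, hψf_def⟩ : ∃ χ : AddChar (FiniteAdeleRing (𝓞 F) F) Circle, χ =
      prodChar (A := fun v : HeightOneSpectrum (𝓞 F) => v.adicCompletionIntegers F) (fun v => ψ.adicComponent v)
        (eventually_forall_adicComponent_apply_eq_one hψ.continuous) := ⟨_, rfl⟩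
  have hψf : ∀ t : FiniteAdeleRing (𝓞 F) F, ψ (finiteAdeleInr F t) = ψf t := fun t => by
    rw [hψf_def, finiteAdeleInr_apply, map_zero_prod_eq_finprod_adicComponent hψc]
    rfl
  have hψfc : Continuous ψf := by
    have : (ψf : FiniteAdeleRing (𝓞 F) F → Circle) = fun t => ψ (finiteAdeleInr F t) := funext fun t => (hψf t).symm
    rw [this]
    exact hψc.comp (continuous_finiteAdeleInr F)
  have hβfc : Continuous fun p : (Fin n → FiniteAdeleRing (𝓞 F) F) × (Fin n → FiniteAdeleRing (𝓞 F) F) =>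
      βf p.1 p.2 := by
    have : (fun p : (Fin n → FiniteAdeleRing (𝓞 F) F) × (Fin n → FiniteAdeleRing (𝓞 F) F) => βf p.1 p.2) =
        fun p => p.1 ⬝ᵥ p.2 := funext fun p => by rw [hβf, Matrix.toLinearMap₂'_apply', Matrix.one_mulVec]
    rw [this]
    exact continuous_fst.dotProduct continuous_snd
  obtain ⟨L₁, hL₁_def⟩ : ∃ L : AddSubgroup (Fin n → FiniteAdeleRing (𝓞 F) F), L =
      AddSubgroup.pi Set.univ fun _ : Fin n =>
        (box (A := fun v : HeightOneSpectrum (𝓞 F) => v.adicCompletionIntegers F) fun v =>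
          (IsUltrametricDist.closedBall_openAddSubgroup (v.adicCompletion F) one_pos).toAddSubgroup) := ⟨_, rfl⟩
  obtain ⟨L₂, hL₂_def⟩ : ∃ L : AddSubgroup (Fin n → FiniteAdeleRing (𝓞 F) F), L =
      AddSubgroup.pi Set.univ fun _ : Fin n =>
        (box (A := fun v : HeightOneSpectrum (𝓞 F) => v.adicCompletionIntegers F) fun v =>
          mulDual (ψ.adicComponent v)) := ⟨_, rfl⟩
  have hL : IsDualLatticePair βf ψf L₁ L₂ := by
    rw [hψf_def, hL₁_def, hL₂_def]
    exact isDualLatticePair_finiteAdele_integers_conductor_pi hψ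
  have hψL : ∀ x ∈ L₁, ∀ y ∈ L₂, ψf (βf x y) = 1 := fun x hx y hy => hL.apply_eq_one hx hy
  have hsep₁ : ∀ x : Fin n → FiniteAdeleRing (𝓞 F) F, x ∉ L₁ → ∃ y ∈ L₂, ψf (βf x y) ≠ 1 :=
    fun x hx => hL.exists_right_ne_one hx
  have hsep₂ : ∀ y : Fin n → FiniteAdeleRing (𝓞 F) F, y ∉ L₂ → ∃ x ∈ L₁, ψf (βf x y) ≠ 1 :=
    fun y hy => hL.exists_left_ne_one hy
  -- the projections
  obtain ⟨p₁, hp₁⟩ := exists_archProj (Φ := Φ) he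
  obtain ⟨p₂, hp₂⟩ := exists_finProj (Φ := Φ) he
  -- the model
  let Q : Type := ((Fin n → FiniteAdeleRing (𝓞 F) F) × (Fin n → FiniteAdeleRing (𝓞 F) F)) ⧸ L₁.prod L₂
  let S : Type := lp (fun _ : Q => Lp ℂ 2 (volume : Measure (Fin m → ℝ))) 2
  let πc : Representation ℂ (Heisenberg (altPolar βM)) S :=
    LatticeModel.coeff L₁ L₂ (Lp ℂ 2 (volume : Measure (Fin m → ℝ))) πa hau
  let τ : Representation ℂ (Heisenberg (polar βf)) S :=
    LatticeModel.rep βf ψf L₁ L₂ (Lp ℂ 2 (volume : Measure (Fin m → ℝ))) hψL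
  have hcomm : ∀ (a : Heisenberg (altPolar βM)) (b : Heisenberg (polar βf)), Commute (πc a) (τ b) := fun a b =>
    LinearMap.ext fun G => (LatticeModel.rep_coeff_comm βf ψf L₁ L₂ _ hψL πa hau b a G).symm
  let ρ : Representation ℂ (AdelicHeisenberg F E V Φ) S :=
    (MonoidHom.noncommCoprod πc τ hcomm).comp (p₁.prod p₂)
  have hρ : ∀ (g : AdelicHeisenberg F E V Φ) (G : S), ρ g G = πc (p₁ g) (τ (p₂ g) G) := fun g G => rfl
  -- nontriviality of the model
  haveI hSn : Nontrivial S := by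
    obtain ⟨v₀, hv₀⟩ := exists_ne (0 : Lp ℂ 2 (volume : Measure (Fin m → ℝ)))
    refine ⟨⟨lp.single 2 (0 : Q) v₀, 0, fun h0 => hv₀ ?_⟩⟩
    have := congrArg (fun G : S => G (0 : Q)) h0
    simpa only [lp.single_apply, Pi.single_eq_same, lp.coeFn_zero, Pi.zero_apply] using this
  -- bookkeeping identities
  have hone₁ : ∀ h : Heisenberg (altPolar βM), h = ⟨h.v, 0⟩ * Heisenberg.ofCenter (altPolar βM)
      (Multiplicative.ofAdd h.t) := fun h => by
    apply Heisenberg.ext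
    · change h.v = h.v + 0
      rw [add_zero]
    · change h.t = 0 + h.t + altPolar βM h.v 0
      rw [map_zero, add_zero, zero_add]
  have hone₂ : ∀ h : Heisenberg (polar βf), h = ⟨h.v, 0⟩ * Heisenberg.ofCenter (polar βf)
      (Multiplicative.ofAdd h.t) := fun h => by
    apply Heisenberg.ext
    · change h.v = h.v + 0
      rw [add_zero]
    · change h.t = 0 + h.t + polar βf h.v 0
      rw [map_zero, add_zero, zero_add]
  have hπc_center : ∀ (s : mixedSpace F) (G : S),
      πc (Heisenberg.ofCenter (altPolar βM) (Multiplicative.ofAdd s)) G = ((𝐞 (ℓ s) : Circle) : ℂ) • G := by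
    intro s G
    apply lp.ext
    funext q
    rw [LatticeModel.coeff_apply, haz, lp.coeFn_smul, Pi.smul_apply]
  have hπc_mk : ∀ (h : Heisenberg (altPolar βM)) (G : S),
      πc h G = ((𝐞 (ℓ h.t) : Circle) : ℂ) • πc ⟨h.v, 0⟩ G := fun h G => by
    conv_lhs => rw [hone₁ h, map_mul, Module.End.mul_apply, hπc_center, map_smul]
  have hτ_mk : ∀ (h : Heisenberg (polar βf)) (G : S), τ h G = ((ψf h.t : Circle) : ℂ) • τ ⟨h.v, 0⟩ G := fun h G => by
    conv_lhs => rw [hone₂ h, map_mul, Module.End.mul_apply, LatticeModel.rep_ofCenter, map_smul]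
  -- continuity data
  have hv : Continuous fun h : AdelicHeisenberg F E V Φ => e.symm h.v :=
    (IsModuleTopology.continuous_of_linearMap
      (e.symm : AdelicSpace F V →ₗ[AdeleRing (𝓞 F) F] (Fin n → AdeleRing (𝓞 F) F) × (Fin n → AdeleRing (𝓞 F) F))).comp
      (continuous_heisenberg_v (heisForm F E V Φ) (adelicSpaceTopology F V) inferInstance)
  have ht : Continuous fun h : AdelicHeisenberg F E V Φ => h.t :=
    continuous_heisenberg_t (heisForm F E V Φ) (adelicSpaceTopology F V) inferInstance
  have harch : Continuous fun h : AdelicHeisenberg F E V Φ =>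
      ((fun i => ringEquiv_mixedSpace F ((⅟(2 : AdeleRing (𝓞 F) F) * (e.symm h.v).1 i).1),
        fun i => ringEquiv_mixedSpace F ((e.symm h.v).2 i).1) : (Fin n → mixedSpace F) × (Fin n → mixedSpace F)) := by
    refine Continuous.prodMk (continuous_pi fun i => (continuous_ringEquiv_mixedSpace F).comp ?_)
      (continuous_pi fun i => (continuous_ringEquiv_mixedSpace F).comp ?_)
    · exact continuous_fst.comp ((continuous_const.mul (continuous_apply i)).comp (continuous_fst.comp hv))
    · exact continuous_fst.comp ((continuous_apply i).comp (continuous_snd.comp hv))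
  have hfin : Continuous fun h : AdelicHeisenberg F E V Φ =>
      ((fun i => ((e.symm h.v).1 i).2, fun i => ((e.symm h.v).2 i).2) :
        (Fin n → FiniteAdeleRing (𝓞 F) F) × (Fin n → FiniteAdeleRing (𝓞 F) F)) := by
    refine Continuous.prodMk (continuous_pi fun i => ?_) (continuous_pi fun i => ?_)
    · exact continuous_snd.comp ((continuous_apply i).comp (continuous_fst.comp hv))
    · exact continuous_snd.comp ((continuous_apply i).comp (continuous_snd.comp hv))
  refine ⟨S, inferInstance, inferInstance, inferInstance, hSn, ρ, fun g G => ?_, fun G => ?_, fun K hKc hK => ?_,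
    fun t G => ?_⟩
  · -- isometry
    rw [hρ, LatticeModel.norm_coeff_apply, LatticeModel.norm_rep_apply]
  · -- continuity of the orbit maps
    have hform : ∀ h : AdelicHeisenberg F E V Φ, ρ h G =
        (((𝐞 (ℓ (ringEquiv_mixedSpace F h.t.1)) : Circle) : ℂ) *
          ((ψf (h.t.2 + ⅟(2 : FiniteAdeleRing (𝓞 F) F) *
            βf (fun i => ((e.symm h.v).1 i).2) (fun i => ((e.symm h.v).2 i).2)) : Circle) : ℂ)) •
        πc ⟨(fun i => ringEquiv_mixedSpace F ((⅟(2 : AdeleRing (𝓞 F) F) * (e.symm h.v).1 i).1),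
              fun i => ringEquiv_mixedSpace F ((e.symm h.v).2 i).1), 0⟩
          (τ ⟨(fun i => ((e.symm h.v).1 i).2, fun i => ((e.symm h.v).2 i).2), 0⟩ G) := by
      intro h
      obtain ⟨w, t⟩ := h
      rw [hρ, hp₁, hp₂, hπc_mk, hτ_mk, map_smul, smul_smul]
      rfl
    have hc : Continuous fun h : AdelicHeisenberg F E V Φ =>
        (((𝐞 (ℓ (ringEquiv_mixedSpace F h.t.1)) : Circle) : ℂ) *
          ((ψf (h.t.2 + ⅟(2 : FiniteAdeleRing (𝓞 F) F) *
            βf (fun i => ((e.symm h.v).1 i).2) (fun i => ((e.symm h.v).2 i).2)) : Circle) : ℂ)) := by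
      refine (continuous_subtype_val.comp ?_).mul (continuous_subtype_val.comp ?_)
      · exact Real.continuous_fourierChar.comp (ℓ.continuous_of_finiteDimensional.comp
          ((continuous_ringEquiv_mixedSpace F).comp (continuous_fst.comp ht)))
      · have hb : Continuous fun h : AdelicHeisenberg F E V Φ =>
            βf (fun i => ((e.symm h.v).1 i).2) (fun i => ((e.symm h.v).2 i).2) := by
          have h0 := hβfc.comp hfin
          simpa only [Function.comp_def] using h0
        exact hψfc.comp ((continuous_snd.comp ht).add (continuous_const.mul hb))
    have hop : Continuous fun h : AdelicHeisenberg F E V Φ =>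
        πc ⟨(fun i => ringEquiv_mixedSpace F ((⅟(2 : AdeleRing (𝓞 F) F) * (e.symm h.v).1 i).1),
              fun i => ringEquiv_mixedSpace F ((e.symm h.v).2 i).1), 0⟩
          (τ ⟨(fun i => ((e.symm h.v).1 i).2, fun i => ((e.symm h.v).2 i).2), 0⟩ G) :=
      LatticeModel.continuous_apply_apply_of_isometry
        (A := fun y : (Fin n → mixedSpace F) × (Fin n → mixedSpace F) => πc ⟨y, 0⟩)
        (fun y X => LatticeModel.norm_coeff_apply L₁ L₂ _ πa hau _ X)
        (fun X => LatticeModel.continuous_coeff_apply L₁ L₂ _ πa hau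
          (fun y : (Fin n → mixedSpace F) × (Fin n → mixedSpace F) => (⟨y, 0⟩ : Heisenberg (altPolar βM))) hac X)
        harch ((LatticeModel.continuous_rep_mk_zero βf ψf L₁ L₂ _ hψL hL.isOpen_left hL.isOpen_right hψfc hβfc
          G).comp hfin)
    rw [show (fun h => ρ h G) = _ from funext hform]
    exact hc.smul hop
  · -- irreducibility
    refine LatticeModel.irreducible βf ψf L₁ L₂ (Lp ℂ 2 (volume : Measure (Fin m → ℝ))) hψL πa hau hsep₁ hsep₂
      ha' K hKc (fun h₂ G hG => ?_) (fun h₁ G hG => ?_)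
    · obtain ⟨g, hg₁, hg₂⟩ := exists_proj_eq_one_fin (Φ := Φ) p₁ hp₁ p₂ hp₂ h₂.v h₂.t
      have hτ : τ h₂ G = ρ g G := by
        rw [hρ, hg₁, hg₂, map_one πc, Module.End.one_apply]
      rw [hτ]
      exact hK g G hG
    · obtain ⟨g, hg₁, hg₂⟩ := exists_proj_eq_one_arch (Φ := Φ) p₁ hp₁ p₂ hp₂ h₁.v h₁.t
      have hπ : πc h₁ G = ρ g G := by
        rw [hρ, hg₁, hg₂, map_one τ, Module.End.one_apply]
      rw [hπ]
      exact hK g G hG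
  · -- central character
    obtain ⟨h1, h2⟩ := proj_ofCenter (Φ := Φ) p₁ hp₁ p₂ hp₂ t
    rw [hρ, h1, h2, LatticeModel.rep_ofCenter, map_smul, hπc_center, smul_smul, ← Circle.coe_mul]
    congr 2
    rw [map_eq_mul_finprod_adicComponent hψc t, hℓψ, mul_comm, hψf_def]
    rfl

end Prop311

end Literature.NumberTheory.GelbartRogawski1991

end
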